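import Summits.QuantumFields.YangMills.Theorems.UnitScaleTiltProp7TwoBackgroundGradientComparison
import Literature.MathematicalPhysics.QuantumFieldTheory.Balaban1983to89.B5Eq118OneStroke
import Literature.MathematicalPhysics.QuantumFieldTheory.Balaban1983to89.B3Taylor310LocalRemainder
import HarnessLib

/-!
# Route `UnitScaleTilt`, crux K1 «MinimiserStabilityRegPr» (stmt-QuantumFields-19200), EX face after S45 — (L3′b)-GRAD FILE **(G1-3b)(i): THE WEIGHTED-SUP ABSORPTION**
# — from a PER-BOND local gradient letter `g(b) ≤ Cg·(m(b) + a·sup_{input ball of b} g)` with exponentially decaying value part `m(b) ≤ M·e^{−κ·d(b)}` and a margin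
# `Cg·a·e^{κD} ≤ ½` to the GLOBAL exponentially weighted gradient row `g(b) ≤ 2·Cg·M·e^{−κ·d(b)}` — the shape of the chair's V6 letter `hDcol` BY TEXT
# (★p1 g25 CHAIR WORD №7 (b), 2026-08-30).

Cell `ym3-torus` (HUMAN RULING D-0037; rung R3 = SU(2) YM₃ on T³ — NOT d = 4, NOT infinite volume, NOT a mass gap, NOT Clay).  Width seat `ym3-torus-px12` (gen 15).
THEOREMS ONLY (0 `def`, 0 `sorry`, default heartbeats); `--supports stmt-QuantumFields-19200 --as helper`; count-neutral.

WHY.  (G1-3) = the curved member gradient row `hDcol : ‖(D_{U₀}ψ_{y,Y})(b)‖ ≤ Cg·e^{−κ·tdist(B b.src, y)}·‖Y‖` for the LOD columns `ψ_{y,Y} = G(T(ι(δ_y ⊗ Y)))`.  Stage (a)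
✓`Prop7CurvedMemberLocalGradient.exists_curved_localGradient` (✓p763385) bounds the η-gradient at the centre of ONE ball by `Cg·(M₀ + a·G)` with `G` the gradient sup on the
13-block INPUT ball and `a = O(ε₀)` — the gradient is NOT absorbed locally (the flat lemma's ball is its mass scale).  THIS FILE is the global half of stage (b): the
absorption closes for the WEIGHTED sup `G♯ := max_b e^{κ·d(b)}·g(b)` over the (finite) torus, because a neighbour `b′` in the input ball of `b` has `d(b) ≤ d(b′) + D`, so
`sup_{ball} g ≤ e^{−κ(d(b) − D)}·G♯`, whence `G♯ ≤ Cg·(M + a·e^{κD}·G♯) ≤ Cg·M + ½G♯`.  [Balaban1985BackgroundPropagators] proves Thm 3.1 (3.42)–(3.44) this way: the local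
estimates (3.45)–(3.47) p.398 on unit cubes, then the exponentially weighted supremum over the lattice, the products of decay factors re-localised by [Balaban1984PropagatorsII] Lemma 2.1.

WHAT IS PROVED (ns `Summit.QuantumFields.YangMills.Theorems.Prop7WeightedGradientAbsorption`).
* §1 ★★ `weighted_sup_absorption` — the abstract statement on a finite index type `ι` (bonds): letters `g d m : ι → ℝ`, a neighbour relation `near` with `near b b′ → d b ≤ d b′ + D`,
  `hloc : ∀ b Gb, (∀ b′, near b b′ → g b′ ≤ Gb) → g b ≤ Cg·(m b + a·Gb)`, `hm : m b ≤ M·e^{−κ·d b}`, margin `Cg·a·e^{κD} ≤ ½` ⟹ `∀ b, g b ≤ 2·Cg·M·e^{−κ·d b}`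
  (maximiser of the weighted family by `Finset.exists_max_image`; no `gradient_absorption` needed, two `linarith`).
* §2 ★★★ `column_gradient_decay_of_perBond` — the member edition in `hDcol`'s currency: bonds `PBond (F.P K) 0`, `g := ‖WL2.equiv ℂ _ W₂ (DL2 F n K c₀ U₀ (ψ y Y)) (bondEquiv F K b)‖`
  for any column family `ψ : Site (F.P K) (K−n) → Matrix (Fin 2) (Fin 2) ℂ → SiteL2K`, `d := tdist(B b.src, y)` (coarse block distance, `iterBlockOf`), `near := tdist(B b.src, B b′.src) ≤ D`,
  value letter `m ≤ M·‖Y‖·e^{−κ·d}`; conclusion `∀ y Y b, g ≤ (2·Cg·M)·e^{−κ·tdist(B b.src, y)}·‖Y‖`.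
* §3 ★★ `hDcol_of_perBond` — §2 at `ψ y Y := G(T(ι(Pi.single y Y)))` with V6's letters `G T ι` typed VERBATIM, concluding `hDcol`'s display with `Cg ↦ 2·Cg·M`.
HYP-SAT (★★OWNER RULING №42).  `hloc`, `hm` are real-inequality schemas between displayed terms; at fixed `(F, n, K)` they are inhabited trivially (`a := 0`, `Cg·m` := the finite
max of `g·e^{κd}`), and — the point — with `K`-FREE `Cg, a, M` on the literal T³ member by stage (a) ✓p763385 transported to the cube axial gauge ((G1-3b)(ii): `a = O(ε₀)·e^{0}`,
`D = 16`-class, `M` from V4∕V5's column decay); `hmargin` is then print's smallness of `ε₀`.  The conclusion is non-vacuous; no `Prop` hypothesis restates it.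
HONEST SCOPE.  Real bookkeeping on a finite set; (G1-3b)(ii) (the per-bond discharge of `hloc`∕`hm`: gauge transport of `D_{U₀}`, the cube axial gauge rows, the (★) modulus, the
decay letters) is NOT here; nothing of V6's composition, the ten print rows, `hT`, `hGF`, EX `stub_existenceMinimalOrbit` or the crux is proved here; the Yang–Mills mass gap is NOT proved.

References: T. Bałaban, CMP **99** (1985) 389–434 [Balaban1985BackgroundPropagators] (Thm 3.1 (3.42)–(3.44) pp.397–398, (3.45)–(3.47) p.398);
CMP **96** (1984) 223–250 [Balaban1984PropagatorsII] (Lemma 2.1 (2.61)–(2.63) p.234).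
-/

set_option autoImplicit false

noncomputable section
open scoped InnerProductSpace ComplexConjugate BigOperators Matrix.Norms.L2Operator

namespace Summit.QuantumFields.YangMills.Theorems.Prop7WeightedGradientAbsorption

open Literature.MathematicalPhysics.QuantumFieldTheory.Balaban1983to89
open Literature.MathematicalPhysics.QuantumFieldTheory.Balaban1983to89.T3ContinuumYM3Torus
open B5Eq118OneStroke (iterBlockOf)
open B3Taylor310LocalRemainder (tdist_triangle)
open B9Eq311L2Pairing (WL2)
open B11Eq103H1Complex (SiteL2K)
open Summit.QuantumFields.YangMills.Theorems.Prop7SectET3Transport (periodsT3 bondEquiv)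
open Summit.QuantumFields.YangMills.Theorems.Prop7SectET3HilbertLetters (W₂ DL2)

/-! ## §1 The abstract weighted-sup absorption on a finite index type -/

/-- ★★ **WEIGHTED-SUP ABSORPTION** (the global step of [Balaban1985BackgroundPropagators] Thm 3.1 (3.42)–(3.44), pp.398–399).  On a finite index type (bonds) with a
distance-to-the-source `d`, a neighbour relation `near` whose neighbours are at most `D` closer to the source (`near b b′ → d b ≤ d b′ + D`), a nonnegative family `g`, a value
family `m ≤ M·e^{−κd}` and a LOCAL estimate `g b ≤ Cg·(m b + a·Gb)` for every bound `Gb` of `g` on the neighbours of `b`: if `Cg·a·e^{κD} ≤ ½` then `g b ≤ 2·Cg·M·e^{−κ·d b}`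
everywhere.  Proof: the weighted family `e^{κ d}·g` attains its max `G♯` at some `b₀`; neighbours obey `g b′ ≤ e^{−κ(d b − D)}·G♯`; so `e^{κ d b}·g b ≤ Cg·(M + a·e^{κD}·G♯)` for
all `b`, at `b₀` this absorbs to `G♯ ≤ 2·Cg·M`. [cite: Balaban1985BackgroundPropagators, Thm 3.1 (3.42)–(3.44) pp.397–398; Balaban1984PropagatorsII, Lemma 2.1 (2.61)–(2.63) p.234] -/
theorem weighted_sup_absorption {ι : Type*} [Fintype ι] (g d m : ι → ℝ) (near : ι → ι → Prop) {Cg a M κ D : ℝ}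
    (hκ : 0 ≤ κ) (hCg : 0 ≤ Cg) (hg0 : ∀ b, 0 ≤ g b)
    (hnear : ∀ b b', near b b' → d b ≤ d b' + D)
    (hloc : ∀ (b : ι) (Gb : ℝ), (∀ b', near b b' → g b' ≤ Gb) → g b ≤ Cg * (m b + a * Gb))
    (hm : ∀ b, m b ≤ M * Real.exp (-(κ * d b)))
    (hmargin : Cg * a * Real.exp (κ * D) ≤ 1 / 2) :
    ∀ b, g b ≤ 2 * Cg * M * Real.exp (-(κ * d b)) := by
  classical
  intro b₁
  have hne : (Finset.univ : Finset ι).Nonempty := ⟨b₁, Finset.mem_univ _⟩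
  obtain ⟨b₀, -, hb₀⟩ := Finset.exists_max_image Finset.univ (fun b => Real.exp (κ * d b) * g b) hne
  -- the weighted sup `G♯`
  set S : ℝ := Real.exp (κ * d b₀) * g b₀ with hS
  have hS0 : 0 ≤ S := mul_nonneg (Real.exp_pos _).le (hg0 b₀)
  have hW : ∀ b, Real.exp (κ * d b) * g b ≤ S := fun b => hb₀ b (Finset.mem_univ b)
  have hgS : ∀ b, g b ≤ Real.exp (-(κ * d b)) * S := by
    intro b
    have h1 : Real.exp (-(κ * d b)) * (Real.exp (κ * d b) * g b) ≤ Real.exp (-(κ * d b)) * S :=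
      mul_le_mul_of_nonneg_left (hW b) (Real.exp_pos _).le
    have h2 : Real.exp (-(κ * d b)) * Real.exp (κ * d b) = 1 := by
      rw [← Real.exp_add, neg_add_cancel, Real.exp_zero]
    calc g b = Real.exp (-(κ * d b)) * Real.exp (κ * d b) * g b := by rw [h2, one_mul]
      _ = Real.exp (-(κ * d b)) * (Real.exp (κ * d b) * g b) := by ring
      _ ≤ Real.exp (-(κ * d b)) * S := h1
  -- every weighted value is bounded through the local estimate fed with the weighted sup on the input ball
  have hkey : ∀ b, Real.exp (κ * d b) * g b ≤ Cg * M + Cg * a * Real.exp (κ * D) * S := by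
    intro b
    have hGb : ∀ b', near b b' → g b' ≤ Real.exp (-(κ * (d b - D))) * S := by
      intro b' hb'
      refine (hgS b').trans (mul_le_mul_of_nonneg_right (Real.exp_le_exp.2 ?_) hS0)
      have := mul_le_mul_of_nonneg_left (hnear b b' hb') hκ
      linarith
    have h1 := hloc b _ hGb
    have h2 : Real.exp (κ * d b) * m b ≤ M := by
      have h3 := mul_le_mul_of_nonneg_left (hm b) (Real.exp_pos (κ * d b)).le
      have h4 : Real.exp (κ * d b) * Real.exp (-(κ * d b)) = 1 := by
        rw [← Real.exp_add, add_neg_cancel, Real.exp_zero]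
      calc Real.exp (κ * d b) * m b ≤ Real.exp (κ * d b) * (M * Real.exp (-(κ * d b))) := h3
        _ = M * (Real.exp (κ * d b) * Real.exp (-(κ * d b))) := by ring
        _ = M := by rw [h4, mul_one]
    have h5 : Real.exp (κ * d b) * Real.exp (-(κ * (d b - D))) = Real.exp (κ * D) := by
      rw [← Real.exp_add]
      congr 1
      ring
    calc Real.exp (κ * d b) * g b ≤ Real.exp (κ * d b) * (Cg * (m b + a * (Real.exp (-(κ * (d b - D))) * S))) :=
          mul_le_mul_of_nonneg_left h1 (Real.exp_pos _).le
      _ = Cg * (Real.exp (κ * d b) * m b) + Cg * a * (Real.exp (κ * d b) * Real.exp (-(κ * (d b - D)))) * S := by ring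
      _ ≤ Cg * M + Cg * a * (Real.exp (κ * d b) * Real.exp (-(κ * (d b - D)))) * S := by
          have := mul_le_mul_of_nonneg_left h2 hCg
          linarith
      _ = Cg * M + Cg * a * Real.exp (κ * D) * S := by rw [h5]
  -- absorption at the maximiser
  have hSle : S ≤ 2 * Cg * M := by
    have h1 := hkey b₀
    have h2 : Cg * a * Real.exp (κ * D) * S ≤ 1 / 2 * S := mul_le_mul_of_nonneg_right hmargin hS0
    linarith
  calc g b₁ ≤ Real.exp (-(κ * d b₁)) * S := hgS b₁
    _ ≤ Real.exp (-(κ * d b₁)) * (2 * Cg * M) := mul_le_mul_of_nonneg_left hSle (Real.exp_pos _).le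
    _ = 2 * Cg * M * Real.exp (-(κ * d b₁)) := by ring

/-! ## §2 The member edition in `hDcol`'s currency -/

variable (F : T3Family) {n K : ℕ} (c₀ : ℝ) [Fact (0 < c₀)]

/-- ★★★ **THE GLOBAL WEIGHTED GRADIENT ROW OF A COLUMN FAMILY FROM ITS PER-BOND LOCAL LETTER** ((G1-3b)(i) at the member).  For a background `U₀`, any column family
`ψ : (y, Y) ↦ ψ_{y,Y}` of site fields, a coarse input radius `D`, and letters `Cg, a, M ≥ ·`, `κ ≥ 0`: if at every bond `b` the gradient `g(b) := ‖(D_{U₀}ψ_{y,Y})(b)‖_{W₂}` obeys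
the LOCAL estimate `g(b) ≤ Cg·(m(b) + a·Gb)` for every bound `Gb` of `g` on the bonds whose blocks are within coarse distance `D` of `b`'s block, with value part
`m(b) ≤ M·‖Y‖·e^{−κ·tdist(B b.src, y)}`, and `Cg·a·e^{κD} ≤ ½`, then `g(b) ≤ (2·Cg·M)·e^{−κ·tdist(B b.src, y)}·‖Y‖` for all `y, Y, b` — §1 with `near b b′ := tdist(B b.src, B b′.src) ≤ D`
(triangle inequality of the coarse torus distance). [cite: Balaban1985BackgroundPropagators, Thm 3.1 (3.42) p.397, (3.45)–(3.47) p.398] -/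
theorem column_gradient_decay_of_perBond (U₀ : GaugeField (F.P K) 0 (Matrix.specialUnitaryGroup (Fin 2) ℂ))
    (ψ : Site (F.P K) (K - n) → Matrix (Fin 2) (Fin 2) ℂ → SiteL2K ℂ 3 (periodsT3 F K) c₀ W₂)
    (m : Site (F.P K) (K - n) → Matrix (Fin 2) (Fin 2) ℂ → PBond (F.P K) 0 → ℝ) {Cg a M κ D : ℝ} (hκ : 0 ≤ κ) (hCg : 0 ≤ Cg)
    (hloc : ∀ (y : Site (F.P K) (K - n)) (Y : Matrix (Fin 2) (Fin 2) ℂ) (b : PBond (F.P K) 0) (Gb : ℝ),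
      (∀ b' : PBond (F.P K) 0, (Site.tdist (P := F.P K) (iterBlockOf (K - n) b.src) (iterBlockOf (K - n) b'.src) : ℝ) ≤ D →
        ‖WL2.equiv ℂ _ W₂ (DL2 F n K c₀ U₀ (ψ y Y)) (bondEquiv F K b')‖ ≤ Gb) →
      ‖WL2.equiv ℂ _ W₂ (DL2 F n K c₀ U₀ (ψ y Y)) (bondEquiv F K b)‖ ≤ Cg * (m y Y b + a * Gb))
    (hm : ∀ (y : Site (F.P K) (K - n)) (Y : Matrix (Fin 2) (Fin 2) ℂ) (b : PBond (F.P K) 0),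
      m y Y b ≤ M * ‖Y‖ * Real.exp (-(κ * (Site.tdist (P := F.P K) (iterBlockOf (K - n) b.src) y : ℝ))))
    (hmargin : Cg * a * Real.exp (κ * D) ≤ 1 / 2) :
    ∀ (y : Site (F.P K) (K - n)) (Y : Matrix (Fin 2) (Fin 2) ℂ) (b : PBond (F.P K) 0),
      ‖WL2.equiv ℂ _ W₂ (DL2 F n K c₀ U₀ (ψ y Y)) (bondEquiv F K b)‖
        ≤ (2 * Cg * M) * Real.exp (-(κ * (Site.tdist (P := F.P K) (iterBlockOf (K - n) b.src) y : ℝ))) * ‖Y‖ := by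
  intro y Y b
  have h := weighted_sup_absorption (ι := PBond (F.P K) 0)
    (fun b' => ‖WL2.equiv ℂ _ W₂ (DL2 F n K c₀ U₀ (ψ y Y)) (bondEquiv F K b')‖)
    (fun b' => (Site.tdist (P := F.P K) (iterBlockOf (K - n) b'.src) y : ℝ)) (m y Y)
    (fun b' b'' => (Site.tdist (P := F.P K) (iterBlockOf (K - n) b'.src) (iterBlockOf (K - n) b''.src) : ℝ) ≤ D)
    (M := M * ‖Y‖) hκ hCg (fun _ => norm_nonneg _)
    (fun b' b'' hb => by
      have ht : (Site.tdist (iterBlockOf (K - n) b'.src) y : ℝ)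
          ≤ (Site.tdist (iterBlockOf (K - n) b'.src) (iterBlockOf (K - n) b''.src) : ℝ) + (Site.tdist (iterBlockOf (K - n) b''.src) y : ℝ) := by
        exact_mod_cast tdist_triangle (iterBlockOf (K - n) b'.src) (iterBlockOf (K - n) b''.src) y
      linarith)
    (fun b' Gb hGb => hloc y Y b' Gb hGb) (fun b' => by simpa only [mul_assoc] using hm y Y b') hmargin b
  calc _ ≤ 2 * Cg * (M * ‖Y‖) * Real.exp (-(κ * (Site.tdist (P := F.P K) (iterBlockOf (K - n) b.src) y : ℝ))) := h
    _ = _ := by ring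

/-! ## §3 The same with V6's letters `G T ι` — `hDcol` by text -/

/-- ★★ **`hDcol` FROM THE PER-BOND LOCAL LETTER** — §2 at the LOD column family `ψ_{y,Y} := G(T(ι(δ_y ⊗ Y)))` of ✓`Prop7ComplementaryProjectorGradientKernel` (V6), the three
maps typed as there; the conclusion is V6's displayed hypothesis `hDcol` with constant `2·Cg·M`. [cite: Balaban1985BackgroundPropagators, Thm 3.1 (3.42) p.397] -/
theorem hDcol_of_perBond {c₁ : ℝ} (U₀ : GaugeField (F.P K) 0 (Matrix.specialUnitaryGroup (Fin 2) ℂ))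
    (ι : (Site (F.P K) (K - n) → Matrix (Fin 2) (Fin 2) ℂ) →ₗ[ℂ] SiteL2K ℂ 3 (periodsT3 F n) c₁ W₂)
    (T : SiteL2K ℂ 3 (periodsT3 F n) c₁ W₂ →ₗ[ℂ] SiteL2K ℂ 3 (periodsT3 F K) c₀ W₂)
    (G : SiteL2K ℂ 3 (periodsT3 F K) c₀ W₂ →ₗ[ℂ] SiteL2K ℂ 3 (periodsT3 F K) c₀ W₂)
    (m : Site (F.P K) (K - n) → Matrix (Fin 2) (Fin 2) ℂ → PBond (F.P K) 0 → ℝ) {Cg a M κ D : ℝ} (hκ : 0 ≤ κ) (hCg : 0 ≤ Cg)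
    (hloc : ∀ (y : Site (F.P K) (K - n)) (Y : Matrix (Fin 2) (Fin 2) ℂ) (b : PBond (F.P K) 0) (Gb : ℝ),
      (∀ b' : PBond (F.P K) 0, (Site.tdist (P := F.P K) (iterBlockOf (K - n) b.src) (iterBlockOf (K - n) b'.src) : ℝ) ≤ D →
        ‖WL2.equiv ℂ _ W₂ (DL2 F n K c₀ U₀ (G (T (ι (Pi.single y Y))))) (bondEquiv F K b')‖ ≤ Gb) →
      ‖WL2.equiv ℂ _ W₂ (DL2 F n K c₀ U₀ (G (T (ι (Pi.single y Y))))) (bondEquiv F K b)‖ ≤ Cg * (m y Y b + a * Gb))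
    (hm : ∀ (y : Site (F.P K) (K - n)) (Y : Matrix (Fin 2) (Fin 2) ℂ) (b : PBond (F.P K) 0),
      m y Y b ≤ M * ‖Y‖ * Real.exp (-(κ * (Site.tdist (P := F.P K) (iterBlockOf (K - n) b.src) y : ℝ))))
    (hmargin : Cg * a * Real.exp (κ * D) ≤ 1 / 2) :
    ∀ (y : Site (F.P K) (K - n)) (Y : Matrix (Fin 2) (Fin 2) ℂ) (b : PBond (F.P K) 0),
      ‖WL2.equiv ℂ _ W₂ (DL2 F n K c₀ U₀ (G (T (ι (Pi.single y Y))))) (bondEquiv F K b)‖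
        ≤ (2 * Cg * M) * Real.exp (-(κ * (Site.tdist (P := F.P K) (iterBlockOf (K - n) b.src) y : ℝ))) * ‖Y‖ :=
  column_gradient_decay_of_perBond F c₀ U₀ (fun y Y => G (T (ι (Pi.single y Y)))) m hκ hCg hloc hm hmargin

end Summit.QuantumFields.YangMills.Theorems.Prop7WeightedGradientAbsorption

end
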